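import Literature.Topology.FourManifolds.ZeroSurgeryHomotopyBallSlice
import HarnessLib

/-!
# The Manolescu–Piccirillo candidate criterion, typed for a census (statement level)

Citation header. C. Manolescu, L. Piccirillo, *From zero surgeries to candidates for exotic
definite 4-manifolds*, J. Lond. Math. Soc. (2) 108 (2023) 2001–2036 = arXiv:2102.04391v3;
K. Nakamura, *Trace embeddings from zero surgery homeomorphisms*, J. Topol. 16 (2023) =
arXiv:2203.14270; Q. Ren, *Lee filtration structure of torus links*, Geom. Topol. 28 (2024)
(Cor. 1.5); N. Dunfield, S. Gong, arXiv:2512.21825 (tables `tab:friends`).  What is reproduced: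
the SHAPE of MP's implication (0surg.tex:816, proof of their Thm 1.3) over the tree's knot
vocabulary, discharged from the two named facts already in the tree
(`Knot.ManolescuPiccirillo2023_lemma33_sphere`, FGMW
`Knot.exists_exotic_of_isHomotopyBallSlice_not_isSmoothlySlice`) plus Rasmussen's slice
obstruction as a NAMED hypothesis; and the data schema of a census row with its decidable
verdict.  Census rows themselves (knots given by PD codes, computed `s`-values) are under
adjudication in the bundle `papers/SmoothPoincare4/sp4-mp-census` and are NOT asserted here:
nothing in this file claims that any particular diagram has any particular invariant.

MP, 0surg.tex:816 (verbatim): "If `K_i` is a knot from our list, then there is a companion knot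
`K'_i` such that `S³₀(K) ≅ S³₀(K'_i)` and `s(K'_i) = −2`. Therefore, `K'_i` is not H-slice in
`#ⁿℂP²` by the inequality (sless). Suppose `K_i` were H-slice in `W = #ⁿℂP²` for some `n`. (The
case `n = 0` corresponds to `S⁴`.) Then Lemma 3.3 would show that `K'` is H-slice in a
4-manifold `X` that is homotopy equivalent to `W`, and therefore homeomorphic to it by Freedman's
theorem. On the other hand, `X` could not be diffeomorphic to `W`, because `K'_i` is not H-slice
in `W`."  Only the case `n = 0` is typed below (the census criterion).
-/

open scoped Manifold ContDiff Topology
open ContinuousMap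

noncomputable section

namespace Literature.Topology.FourManifolds

namespace MPCensus

/-- **Rasmussen's slice obstruction**, as a property of an integer knot invariant `s`
(Rasmussen, Invent. Math. 182 (2010), Thm 1: `|s(K)| ≤ 2 g₄(K)`, hence `K` smoothly slice ⇒
`s(K) = 0`; for `s` over an arbitrary field `𝔽`: Mackaay–Turner–Vaz / Lipshitz–Sarkar, and
Ren, Geom. Topol. 28 (2024) Cor. 1.5 with `Σ` a disc).  The invariant is NOT constructed in the
tree; consumers name the invariant they computed and take this as a hypothesis.
[cite: Rasmussen2010, Thm 1] -/
def SliceObstruction (s : Knot → ℤ) : Prop :=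
  ∀ K : Knot, K.IsSmoothlySlice → s K = 0

/-- "`K` and `K'` have a common `0`-surgery": some `3`-manifold `Y` is `0`-surgery on both
(the tree's rendering of `S³₀(K) ≅ S³₀(K')`, see `ZeroSurgeryHomotopyBallSlice`).
[cite: ManolescuPiccirillo2023, Thm 1.2] -/
def CommonZeroSurgery (K K' : Knot) : Prop :=
  ∃ (Y : Type) (_ : TopologicalSpace Y) (_ : ChartedSpace (EuclideanSpace ℝ (Fin 3)) Y),
    (FramedLink.single K 0).IsSurgery (𝓡 3) Y ∧ (FramedLink.single K' 0).IsSurgery (𝓡 3) Y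

/-- **The census criterion (MP, proof of Thm 1.3, case `n = 0`)**, DISCHARGED over the tree's
vocabulary: given MP Lemma 3.3 (`W = S⁴`), the FGMW lemma and Rasmussen's obstruction for the
invariant `s` used, a pair `(K, K')` with a common `0`-surgery and `s(K') ≠ 0` turns "`K` is
smoothly slice" into an exotic `S⁴`. [cite: ManolescuPiccirillo2023, Thm 1.3 (proof), §1 p. 1] -/
theorem exotic_of_flagged_pair
    (hMP : Knot.ManolescuPiccirillo2023_lemma33_sphere)
    (hFGMW : Knot.exists_exotic_of_isHomotopyBallSlice_not_isSmoothlySlice)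
    {s : Knot → ℤ} (hRas : SliceObstruction s)
    {K K' : Knot} (h0 : CommonZeroSurgery K K') (hs : s K' ≠ 0) (hK : K.IsSmoothlySlice) :
    ∃ (M : Type) (_ : TopologicalSpace M) (_ : T2Space M) (_ : SecondCountableTopology M)
      (_ : ChartedSpace (EuclideanSpace ℝ (Fin 4)) M) (_ : IsManifold (𝓡 4) ∞ M) (_ : CompactSpace M),
      Nonempty (M ≃ₕ (Metric.sphere (0 : EuclideanSpace ℝ (Fin 5)) 1)) ∧
        IsEmpty (M ≃ₘ⟮𝓡 4, 𝓡 4⟯ (Metric.sphere (0 : EuclideanSpace ℝ (Fin 5)) 1)) := by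
  obtain ⟨Y, _, _, h1, h2⟩ := h0
  have hK' : ¬ K'.IsSmoothlySlice := fun h => hs (hRas K' h)
  exact Knot.ManolescuPiccirillo2023_lemma33_sphere.exists_exotic hMP hFGMW ⟨K, K', Y, _, _, h1, h2, hK, hK'⟩

/-- Contrapositive bookkeeping used by every "excluded(X-NR)" census row: if sliceness of `K`
forces `s(K') = 0` (Nakamura Thm 3.13(3) + Ren Cor 1.5 for special RBG links with `R`
biprojectively H-slice or `r` outside `[PF₋(R), PF₊(R)]` — taken as the hypothesis `hNR`), then a
nonzero `s(K')` shows `K` is not smoothly slice. [cite: Nakamura2023, Thm 3.13(3)] -/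
theorem not_slice_of_prefilter {s : Knot → ℤ} {K K' : Knot}
    (hNR : K.IsSmoothlySlice → s K' = 0) (hs : s K' ≠ 0) : ¬ K.IsSmoothlySlice :=
  fun h => hs (hNR h)

/-! ## Census row schema (data only) and its decidable verdict -/

/-- Recorded status of "`K` is smoothly slice" for a census row. [folklore] -/
inductive SliceStatus
  | open_
  | refuted (thm : String)
  | slice (cert : String)
  deriving DecidableEq, Repr

/-- Verdict of a census row. `disproof` = MP-flag certified by two programs AND `K` slice with a
certificate: by `exotic_of_flagged_pair` that row would exhibit an exotic `S⁴`. [folklore] -/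
inductive Verdict
  | candidate
  | excluded (code : String)
  | undecided (what : String)
  | disproof (cert : String)
  deriving DecidableEq, Repr

/-- One census row, data only (booleans/integers copied from the bundle's CANDIDATES.jsonl):
`c1Certified` = exact triangulation-isomorphism certificate of the common `0`-surgery;
`sQ sF2 sF3` = the computed `s` of `K'` over `ℚ, 𝔽₂, 𝔽₃` (`none` = not computed);
`sTwoEngines` = EVERY reported `s`-value (zero or not) reproduced by a second independent
program on the same diagram (bundle REFEREE.md §2(ii),(iv): a value from one program is not
certified, and "excluded: s(K') = 0" is a reason only with two-engine `s`);
`prefilterClause` = the Nakamura–Ren clause applies to the row's `(R, r)`. [folklore] -/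
structure Row where
  pair : String
  c1Certified : Bool
  sQ : Option Int
  sF2 : Option Int
  sF3 : Option Int
  sTwoEngines : Bool
  prefilterClause : Bool
  kStatus : SliceStatus
  deriving Repr

/-- Some computed `s(K')` is nonzero. [folklore] -/
def Row.sNonzero (row : Row) : Bool :=
  (row.sQ.getD 0 != 0) || (row.sF2.getD 0 != 0) || (row.sF3.getD 0 != 0)

/-- All three `s(K')` computed and zero. [folklore] -/
def Row.sAllZero (row : Row) : Bool :=
  row.sQ == some 0 && row.sF2 == some 0 && row.sF3 == some 0

/-- The row verdict (bundle CRITERION.md §2, REFEREE.md §2(ii),(iv)).  Every verdict that rests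
on a computed `s`-value — `candidate`, `disproof`, `X-S0`, `X-NR`, `X-SLICE-BOTH` — requires
`sTwoEngines`; with one program only, the row is `undecided (U-ENGINE …)`, except that a row whose
`(R, r)` satisfies the Nakamura–Ren clause can never be a candidate whatever `s(K')` is (`s = 0`
kills the flag, `s ≠ 0` kills "`K` slice"), so it is `excluded (X-PF …)` with the non-sliceness of
`K` explicitly left uncertified. [folklore] -/
def verdict (row : Row) : Verdict :=
  match row.kStatus with
  | .refuted t  => .excluded ("X-REFUTED: " ++ t)
  | .slice c    =>
    if !row.c1Certified then .undecided "U-C1: 0-surgery homeomorphism not certified (K slice)"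
    else if !row.sTwoEngines then .undecided ("U-ENGINE: K slice, s(K') from one program only — " ++ c)
    else if row.sAllZero then .excluded ("X-SLICE-BOTH: " ++ c)
    else if row.sNonzero then .disproof c
    else .undecided ("U-S: K slice, s(K') not computed over all fields — " ++ c)
  | .open_ =>
    if !row.c1Certified then .undecided "U-C1: 0-surgery homeomorphism not certified"
    else if !row.sTwoEngines then
      (if row.prefilterClause then
        .excluded "X-PF: never a candidate (N10(3)+R1 clause on (R,r)); K non-slice NOT certified (one program)"
      else .undecided "U-ENGINE: s(K') from one program only")
    else if row.sAllZero then .excluded "X-S0: s_F(K') = 0 for F = Q, F2, F3 (two programs)"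
    else if row.sNonzero && row.prefilterClause then .excluded "X-NR: K not slice by N10(3)+R1 (two programs)"
    else if row.sNonzero then .candidate
    else .undecided "U-S: s(K') not computed over all fields"

/-- No verdict that rests on `s(K')` is reached from a single program: `candidate`, `disproof` and
the `s`-based exclusions all need `sTwoEngines`. [folklore] -/
theorem candidate_two_engines (row : Row) (h : verdict row = .candidate) :
    row.sTwoEngines = true ∧ row.c1Certified = true ∧ row.prefilterClause = false := by
  unfold verdict at h
  rcases row with ⟨_, c1, sQ, sF2, sF3, te, pf, ks⟩
  cases ks <;> cases c1 <;> cases te <;> cases pf <;> simp_all <;> split_ifs at h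

/-- A single-program row is never `candidate` and never `disproof`. [folklore] -/
theorem one_engine_undecided_or_prefilter (row : Row) (h : row.sTwoEngines = false) :
    verdict row ≠ .candidate ∧ ∀ c, verdict row ≠ .disproof c := by
  unfold verdict
  rcases row with ⟨_, c1, sQ, sF2, sF3, te, pf, ks⟩
  cases ks <;> cases c1 <;> cases pf <;> simp_all

/-- A flagged row with `K` slice is never silently excluded: it is a DISPROOF verdict. [folklore] -/
theorem disproof_of_slice_flag (row : Row) (c : String) (hk : row.kStatus = .slice c)
    (h1 : row.c1Certified = true) (hs : row.sNonzero = true) (h2 : row.sTwoEngines = true) :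
    verdict row = .disproof c := by
  have hz : row.sAllZero = false := by
    unfold Row.sAllZero; unfold Row.sNonzero at hs
    rcases row with ⟨_, _, sQ, sF2, sF3, _, _, _⟩
    rcases sQ with _ | a <;> rcases sF2 with _ | b <;> rcases sF3 with _ | c <;> simp_all
    omega
  unfold verdict; rw [hk]; simp [h1, hz, hs, h2]

/-- Shape of a Dunfield–Gong `tab:friends` reproduction row (`R` = unknot ⇒ pre-filter clause):
the flag is a non-sliceness certificate for `K`, never a candidate. [folklore] -/
def rowDGShape : Row :=
  { pair := "DG tab:friends shape", c1Certified := true, sQ := some 2, sF2 := some 0,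
    sF3 := some 2, sTwoEngines := true, prefilterClause := true, kStatus := .open_ }

example : verdict rowDGShape = .excluded "X-NR: K not slice by N10(3)+R1 (two programs)" := by decide

/-- The same shape with `s` from one program only: excluded as a candidate, but the non-sliceness
of `K` is NOT asserted. [folklore] -/
def rowDGShapeOneEngine : Row :=
  { pair := "DG tab:friends shape, one program", c1Certified := true, sQ := some 2, sF2 := some 0,
    sF3 := some 2, sTwoEngines := false, prefilterClause := true, kStatus := .open_ }

set_option maxRecDepth 2000 in
example : verdict rowDGShapeOneEngine =
    .excluded "X-PF: never a candidate (N10(3)+R1 clause on (R,r)); K non-slice NOT certified (one program)" := by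
  decide

/-- An N1-type row (`R = J` knotted, clause false) with a one-program zero is NOT excluded: a
single-program `s = 0` could hide a candidate. [folklore] -/
def rowN1ShapeOneEngineZero : Row :=
  { pair := "N1 shape, one program, s = 0", c1Certified := true, sQ := some 0, sF2 := some 0,
    sF3 := some 0, sTwoEngines := false, prefilterClause := false, kStatus := .open_ }

example : verdict rowN1ShapeOneEngineZero = .undecided "U-ENGINE: s(K') from one program only" := by
  decide

end MPCensus

end Literature.Topology.FourManifolds

end
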